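import Summits.CriticalPhenomena.PercolationContinuityZ3.Theorems.FK.NewmanCovarianceInequality
import HarnessLib

/-!
# NEWMAN'S INEQUALITY FOR DOMINATED (NOT NECESSARILY MONOTONE) FAMILIES UNDER A POSITIVELY ASSOCIATED MEASURE:
# `|E e^{i Σ_j L_j} − Π_j E e^{i L_j}| ≤ 2 Σ_{j ≠ k} Cov(Λ_j, Λ_k)` whenever each `L_j` is dominated by an increasing `Λ_j`

Claimed R42 (8)(c) in the cell INBOX at 2026-08-28T14:25:01Z by fkp-10a gen 354 (NEW CLAIM #3 of the gen), addressed to coordinator fk-4 g274 (seated 13:10Z 2026-08-28 by l.8389; R151 l.8390, R152 l.8413); lineage row FO-10a-g354g (self-suggested), package g354-cltgeneral, label GD-A.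
Helper file of the `fk-continuity` build cell (bschramm lane; `--supports stmt-CriticalPhenomena-4575`); builds on
p205010 (kernel theorem, internal audit signed; external expert review pending). No definitions, no named facts, no
sorries; standard axioms. UNCONDITIONAL. GENERIC (a positively associated probability measure `μ` on a preordered
measurable space).

`NewmanCovarianceInequality.lean` proves Newman's Thm. 1 (1980) for INCREASING variables `Y_j` and real
coefficients, through the Lipschitz-domination lemma `norm_integral_cexp_mul_sub_mul_le`, which only needs that the
phases `L`, `M` are DOMINATED by increasing bounded `Λ`, `Λ'` (`|L ω' − L ω| ≤ Λ ω' − Λ ω` for `ω ≤ ω'`). Running the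
same induction with a dominated family gives the extension recorded here:

* `dominated_sum` — a finite sum of dominated functions is dominated by the sum of the dominating functions;
* `dominated_sub_const`, `dominated_const_mul` — bookkeeping;
* `norm_integral_cexp_sum_sub_prod_le_of_dominated` — **`‖E exp(i Σ_{j∈s} L_j) − Π_{j∈s} E exp(i L_j)‖ ≤
  2 Σ_{j∈s} Σ_{k∈s, k≠j} Cov(Λ_j, Λ_k)`** for measurable bounded `L_j` dominated by measurable bounded `Λ_j`.

Use: every function of finitely many edge variables is a difference of two increasing ones, hence dominated by an
increasing one (`M · #open edges`), so Newman's block argument and CLT extend from increasing to ARBITRARY bounded local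
observables (Newman 1983, "A general central limit theorem for FKG systems", via covariances of the dominating
coordinates) — the companion `NewmanCLTDominated.lean`.

## References

* C. M. Newman, *Normal fluctuations and the FKG inequalities*, Comm. Math. Phys. 74 (1980) 119–128, Thm. 1 and the
  remark after (12) (only domination by the FKG variables is used). [Newman1980]
* G. Grimmett, *The Random-Cluster Model*, Springer 2006, Thm. (2.16), Thm. (4.17)(b). [Grimmett2006]
-/

noncomputable section

namespace Summit.CriticalPhenomena.PercolationContinuityZ3.Theorems.FK

namespace NewmanCLT

open MeasureTheory ProbabilityTheory Complex Finset
open Literature.Probability.Percolation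

variable {Ω : Type*}

section Domination

variable [Preorder Ω]

/-- A finite sum of dominated functions is dominated by the sum of the dominators. [cite: Newman1980, Thm. 1 (proof)] -/
theorem dominated_sum {ι : Type*} (s : Finset ι) {L Λ : ι → Ω → ℝ}
    (h : ∀ j ∈ s, ∀ ⦃ω ω'⦄, ω ≤ ω' → |L j ω' - L j ω| ≤ Λ j ω' - Λ j ω) :
    ∀ ⦃ω ω'⦄, ω ≤ ω' →
      |∑ j ∈ s, L j ω' - ∑ j ∈ s, L j ω| ≤ ∑ j ∈ s, Λ j ω' - ∑ j ∈ s, Λ j ω := by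
  intro ω ω' hle
  rw [← Finset.sum_sub_distrib, ← Finset.sum_sub_distrib]
  exact (Finset.abs_sum_le_sum_abs _ _).trans (Finset.sum_le_sum fun j hj => h j hj hle)

/-- Domination is insensitive to additive constants. [folklore] -/
theorem dominated_sub_const {L Λ : Ω → ℝ} (h : ∀ ⦃ω ω'⦄, ω ≤ ω' → |L ω' - L ω| ≤ Λ ω' - Λ ω) (c : ℝ) :
    ∀ ⦃ω ω'⦄, ω ≤ ω' → |(L ω' - c) - (L ω - c)| ≤ Λ ω' - Λ ω := by
  intro ω ω' hle
  rw [sub_sub_sub_cancel_right]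
  exact h hle

/-- Scaling a dominated function by `t` scales the dominator by `|t|`. [folklore] -/
theorem dominated_const_mul {L Λ : Ω → ℝ} (h : ∀ ⦃ω ω'⦄, ω ≤ ω' → |L ω' - L ω| ≤ Λ ω' - Λ ω) (t : ℝ) :
    ∀ ⦃ω ω'⦄, ω ≤ ω' → |t * L ω' - t * L ω| ≤ |t| * Λ ω' - |t| * Λ ω := by
  intro ω ω' hle
  rw [← mul_sub, ← mul_sub, abs_mul]
  exact mul_le_mul_of_nonneg_left (h hle) (abs_nonneg t)

end Domination

section Newman

variable [MeasurableSpace Ω] [Preorder Ω] {μ : Measure Ω}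

/-- **NEWMAN'S INEQUALITY FOR DOMINATED FAMILIES**: under a positively associated probability measure, for measurable
bounded `L_j` dominated by measurable bounded (increasing) `Λ_j`, `j ∈ s`:
`‖E exp(i Σ_{j∈s} L_j) − Π_{j∈s} E exp(i L_j)‖ ≤ 2 Σ_{j∈s} Σ_{k∈s∖{j}} Cov(Λ_j, Λ_k)`.
The increasing case `L_j = t_j Y_j`, `Λ_j = |t_j| Y_j` is `norm_integral_cexp_sum_sub_prod_le`.
[cite: Newman1980, Thm. 1 (11) and the remark after (12)] -/
theorem norm_integral_cexp_sum_sub_prod_le_of_dominated [IsProbabilityMeasure μ] (hμ : IsPositivelyAssociated μ)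
    {ι : Type*} [DecidableEq ι] (s : Finset ι) {L Λ : ι → Ω → ℝ} (hLm : ∀ j ∈ s, Measurable (L j))
    (hΛm : ∀ j ∈ s, Measurable (Λ j)) (hLb : ∀ j ∈ s, ∃ C, ∀ ω, |L j ω| ≤ C) (hΛb : ∀ j ∈ s, ∃ C, ∀ ω, |Λ j ω| ≤ C)
    (hdom : ∀ j ∈ s, ∀ ⦃ω ω'⦄, ω ≤ ω' → |L j ω' - L j ω| ≤ Λ j ω' - Λ j ω) :
    ‖∫ ω, cexp (((∑ j ∈ s, L j ω : ℝ) : ℂ) * I) ∂μ - ∏ j ∈ s, ∫ ω, cexp (((L j ω : ℝ) : ℂ) * I) ∂μ‖ ≤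
      2 * ∑ j ∈ s, ∑ k ∈ s.erase j, cov[Λ j, Λ k; μ] := by
  induction s using Finset.induction_on with
  | empty => simp
  | insert a s ha ih =>
    have hLm' : ∀ j ∈ s, Measurable (L j) := fun j hj => hLm j (mem_insert_of_mem hj)
    have hΛm' : ∀ j ∈ s, Measurable (Λ j) := fun j hj => hΛm j (mem_insert_of_mem hj)
    have hLb' : ∀ j ∈ s, ∃ C, ∀ ω, |L j ω| ≤ C := fun j hj => hLb j (mem_insert_of_mem hj)
    have hΛb' : ∀ j ∈ s, ∃ C, ∀ ω, |Λ j ω| ≤ C := fun j hj => hΛb j (mem_insert_of_mem hj)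
    have hdom' : ∀ j ∈ s, ∀ ⦃ω ω'⦄, ω ≤ ω' → |L j ω' - L j ω| ≤ Λ j ω' - Λ j ω :=
      fun j hj => hdom j (mem_insert_of_mem hj)
    have IH := ih hLm' hΛm' hLb' hΛb' hdom'
    have haL : Measurable (L a) := hLm a (mem_insert_self a s)
    have haΛ : Measurable (Λ a) := hΛm a (mem_insert_self a s)
    -- the pieces
    set SL : Ω → ℝ := fun ω => ∑ j ∈ s, L j ω with hSL
    set SΛ : Ω → ℝ := fun ω => ∑ j ∈ s, Λ j ω with hSΛ
    have hSLm : Measurable SL := Finset.measurable_sum _ fun j hj => hLm' j hj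
    have hSΛm : Measurable SΛ := Finset.measurable_sum _ fun j hj => hΛm' j hj
    choose! C hC using hΛb'
    have hSΛb : ∃ B, ∀ ω, |SΛ ω| ≤ B :=
      ⟨∑ j ∈ s, C j, fun ω => (Finset.abs_sum_le_sum_abs _ _).trans (Finset.sum_le_sum fun j hj => hC j hj ω)⟩
    have hdomS : ∀ ⦃ω ω'⦄, ω ≤ ω' → |SL ω' - SL ω| ≤ SΛ ω' - SΛ ω := dominated_sum s hdom'
    have key := norm_integral_cexp_mul_sub_mul_le hμ hSLm haL hSΛm haΛ hSΛb (hΛb a (mem_insert_self a s)) hdomS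
      (hdom a (mem_insert_self a s))
    -- `Cov(Σ Λ_j, Λ_a) = Σ_j Cov(Λ_j, Λ_a)`
    have m2 : ∀ j ∈ insert a s, MemLp (Λ j) 2 μ := fun j hj => by
      obtain ⟨Cj, hCj⟩ := hΛb j hj
      exact memLp_of_abs_le (hΛm j hj) hCj 2
    have hcov : cov[SΛ, Λ a; μ] = ∑ j ∈ s, cov[Λ j, Λ a; μ] := by
      rw [hSΛ, covariance_fun_sum_left' (fun j hj => m2 j (mem_insert_of_mem hj)) (m2 a (mem_insert_self a s))]
    -- split the exponential of the sum
    have hsplit : ∀ ω, cexp (((∑ j ∈ insert a s, L j ω : ℝ) : ℂ) * I) =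
        cexp ((SL ω : ℂ) * I) * cexp (((L a ω : ℝ) : ℂ) * I) := by
      intro ω
      rw [Finset.sum_insert ha, ← Complex.exp_add]
      congr 1
      simp only [hSL]
      push_cast
      ring
    simp_rw [hsplit]
    rw [Finset.prod_insert ha]
    have htel : ∫ ω, cexp ((SL ω : ℂ) * I) * cexp (((L a ω : ℝ) : ℂ) * I) ∂μ -
          (∫ ω, cexp (((L a ω : ℝ) : ℂ) * I) ∂μ) * ∏ j ∈ s, ∫ ω, cexp (((L j ω : ℝ) : ℂ) * I) ∂μ =
        (∫ ω, cexp ((SL ω : ℂ) * I) * cexp (((L a ω : ℝ) : ℂ) * I) ∂μ -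
            (∫ ω, cexp ((SL ω : ℂ) * I) ∂μ) * ∫ ω, cexp (((L a ω : ℝ) : ℂ) * I) ∂μ) +
          (∫ ω, cexp ((SL ω : ℂ) * I) ∂μ - ∏ j ∈ s, ∫ ω, cexp (((L j ω : ℝ) : ℂ) * I) ∂μ) *
            ∫ ω, cexp (((L a ω : ℝ) : ℂ) * I) ∂μ := by ring
    rw [htel]
    refine (norm_add_le _ _).trans ?_
    rw [norm_mul]
    have hIH' : ‖∫ ω, cexp ((SL ω : ℂ) * I) ∂μ - ∏ j ∈ s, ∫ ω, cexp (((L j ω : ℝ) : ℂ) * I) ∂μ‖ *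
        ‖∫ ω, cexp (((L a ω : ℝ) : ℂ) * I) ∂μ‖ ≤ 2 * ∑ j ∈ s, ∑ k ∈ s.erase j, cov[Λ j, Λ k; μ] := by
      refine (mul_le_of_le_one_right (norm_nonneg _) (norm_integral_cexp_mul_I_le_one _)).trans ?_
      simpa [hSL] using IH
    refine (add_le_add (key.trans (le_of_eq (by rw [hcov]))) hIH').trans (le_of_eq ?_)
    -- bookkeeping of the double sum over `insert a s`
    rw [Finset.sum_insert ha, Finset.erase_insert ha]
    have hinner : ∀ j ∈ s, ∑ k ∈ (insert a s).erase j, cov[Λ j, Λ k; μ] =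
        cov[Λ j, Λ a; μ] + ∑ k ∈ s.erase j, cov[Λ j, Λ k; μ] := by
      intro j hj
      have hja : j ≠ a := fun h => ha (h ▸ hj)
      rw [Finset.erase_insert_of_ne hja.symm, Finset.sum_insert (fun h => ha (Finset.mem_of_mem_erase h))]
    rw [Finset.sum_congr rfl hinner, Finset.sum_add_distrib]
    have hS1 : ∑ k ∈ s, cov[Λ a, Λ k; μ] = ∑ j ∈ s, cov[Λ j, Λ a; μ] :=
      Finset.sum_congr rfl fun k _ => covariance_comm _ _
    rw [hS1]
    ring

/-- A real-coefficient form: for `L_j` dominated by `Λ_j` and reals `t_j`,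
`‖E exp(i Σ_j t_j L_j) − Π_j E exp(i t_j L_j)‖ ≤ 2 Σ_{j} Σ_{k≠j} |t_j| |t_k| Cov(Λ_j, Λ_k)`.
[cite: Newman1980, Thm. 1 (11)] -/
theorem norm_integral_cexp_sum_mul_sub_prod_le_of_dominated [IsProbabilityMeasure μ] (hμ : IsPositivelyAssociated μ)
    {ι : Type*} [DecidableEq ι] (s : Finset ι) {L Λ : ι → Ω → ℝ} (hLm : ∀ j ∈ s, Measurable (L j))
    (hΛm : ∀ j ∈ s, Measurable (Λ j)) (hLb : ∀ j ∈ s, ∃ C, ∀ ω, |L j ω| ≤ C) (hΛb : ∀ j ∈ s, ∃ C, ∀ ω, |Λ j ω| ≤ C)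
    (hdom : ∀ j ∈ s, ∀ ⦃ω ω'⦄, ω ≤ ω' → |L j ω' - L j ω| ≤ Λ j ω' - Λ j ω) (t : ι → ℝ) :
    ‖∫ ω, cexp (((∑ j ∈ s, t j * L j ω : ℝ) : ℂ) * I) ∂μ - ∏ j ∈ s, ∫ ω, cexp (((t j * L j ω : ℝ) : ℂ) * I) ∂μ‖ ≤
      2 * ∑ j ∈ s, ∑ k ∈ s.erase j, |t j| * |t k| * cov[Λ j, Λ k; μ] := by
  have h := norm_integral_cexp_sum_sub_prod_le_of_dominated hμ s (L := fun j ω => t j * L j ω)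
    (Λ := fun j ω => |t j| * Λ j ω) (fun j hj => (hLm j hj).const_mul _) (fun j hj => (hΛm j hj).const_mul _)
    (fun j hj => by
      obtain ⟨C, hC⟩ := hLb j hj
      exact ⟨|t j| * C, fun ω => by rw [abs_mul]; exact mul_le_mul_of_nonneg_left (hC ω) (abs_nonneg _)⟩)
    (fun j hj => by
      obtain ⟨C, hC⟩ := hΛb j hj
      exact ⟨|t j| * C, fun ω => by rw [abs_mul, abs_abs]; exact mul_le_mul_of_nonneg_left (hC ω) (abs_nonneg _)⟩)
    (fun j hj => dominated_const_mul (hdom j hj) (t j))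
  refine h.trans (le_of_eq ?_)
  congr 1
  refine Finset.sum_congr rfl fun j _ => Finset.sum_congr rfl fun k _ => ?_
  rw [covariance_const_mul_left, covariance_const_mul_right]
  ring

end Newman

end NewmanCLT

end Summit.CriticalPhenomena.PercolationContinuityZ3.Theorems.FK
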